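import Mathlib.Data.Nat.Choose.Multinomial
import Mathlib.Algebra.BigOperators.Ring.Finset
import Mathlib.Algebra.BigOperators.Fin
import Mathlib.Algebra.Algebra.Basic
import Mathlib.LinearAlgebra.Vandermonde
import Mathlib.LinearAlgebra.Matrix.NonsingularInverse
import Mathlib.Algebra.Polynomial.AlgebraMap
import Mathlib.Algebra.Polynomial.Splits
import Mathlib.FieldTheory.IsAlgClosed.Basic
import HarnessLib

/-!
# The three algebraic identities behind the chasm at depth three

Topic `Literature/Computability/AlgebraicComplexity`; support file for the discharge of the named
fact `sigmaPiSigma_edgeSize_le_of_complexity` (`DepthThreeChasm.lean`: Gupta–Kamath–Kayal–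
Saptharishi, *Arithmetic circuits: a chasm at depth three*, SIAM J. Comput. 45 (2016) = ECCC
TR13-026, Thm. 1.1, with Tavenas' depth-four step). This file contains the ring-theoretic
identities of Steps 2 and 3 of the printed proof (TR13-026 §4.2–§4.3), stated over an arbitrary
commutative ring / commutative algebra over a field of characteristic zero, with Mathlib-only
imports:

* `fischer` (**Fischer's identity**, TR13-026 Lemma 4.3 [Fis94]): for `y : ι → R`,
  `∑_{ε : ι → {±1}} (∏_j ε_j) · (∑_j ε_j y_j)^{#ι} = 2^{#ι} · (#ι)! · ∏_j y_j` — a product of `W`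
  factors is a linear combination of `2^W` `W`-th powers of `±`-combinations of the factors (the
  printed lemma fixes `ε₁ = 1` and uses `2^{W-1}` powers; summing over all sign vectors doubles
  the count and avoids the case distinction). `fischer_inv` is the divided form over an algebra
  over a field of characteristic zero.
* `exists_dual_weights`, `duality` (**Saxena's duality trick**, TR13-026 Lemma 4.6 [Sax08],
  proof reproduced there): with `E_W(w) = ∑_{e ≤ W} w^e / e!` and any `mW + 1` distinct nodes
  `α_u` (here `α_u = u`) there are weights `β_u` with
  `(y₁ + ⋯ + y_m)^W = ∑_u β_u ∏_v E_W(α_u y_v)`. The weights are a row of the inverse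
  Vandermonde matrix (interpolation of the coefficient of `z^W` in `∏_v E_W(y_v z)`), and the
  coefficient identity is the multinomial theorem.
* `truncExp_eq_aeval`, `aeval_eq_leadingCoeff_mul_prod_roots` (TR13-026, proof of Lemma 4.7):
  `E_W(α · a ℓ^{e₀})` is a univariate polynomial of degree `≤ e₀ W` evaluated at `ℓ`, and over
  an algebraically closed field a univariate `g` evaluated at `ℓ` is
  `lc(g) · ∏_{ρ ∈ roots g} (ℓ - ρ)` with `#roots = deg g`.

Nothing here is a named fact; everything is proved (D-0026). No definitions are introduced: the
sign of a bit `e : Fin 2` is written `(-1) ^ (e : ℕ)` and the truncated exponential is written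
out as a `Finset.range` sum.

## References

* A. Gupta, P. Kamath, N. Kayal, R. Saptharishi, *Arithmetic circuits: a chasm at depth three*,
  ECCC TR13-026 (2013) = FOCS 2013 = SIAM J. Comput. 45(3) (2016) 1064–1079: Lemma 4.3, 4.6, 4.7.
* I. Fischer, *Sums of like powers of multivariate linear forms*, Math. Mag. 67 (1994) 59–61.
* N. Saxena, *Diagonal circuit identity testing and lower bounds*, ICALP 2008, LNCS 5125, 60–71.
-/

noncomputable section

open Finset

namespace Literature.Computability.AlgebraicComplexity.DepthThreeChasm

/-! ## Sign sums -/

section Signs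

variable {R : Type*} [CommRing R]

/-- `∑_{e ∈ {0,1}} ((-1)^e)^n = 1 + (-1)^n`. [folklore] -/
theorem sum_neg_one_pow_pow (n : ℕ) :
    ∑ e : Fin 2, ((-1 : R) ^ (e : ℕ)) ^ n = 1 + (-1) ^ n := by
  simp [Fin.sum_univ_two]

/-- `1 + (-1)^(n+1)` is `2` for odd `n` and `0` for even `n`. [folklore] -/
theorem one_add_neg_one_pow_succ (n : ℕ) :
    (1 : R) + (-1) ^ (n + 1) = if Odd n then 2 else 0 := by
  rcases Nat.even_or_odd n with h | h
  · rw [if_neg (Nat.not_odd_iff_even.2 h), pow_succ, h.neg_one_pow]; ring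
  · rw [if_pos h, pow_succ, h.neg_one_pow]; ring

/-- Orthogonality of signs: `∑_{ε : ι → {±1}} ∏_j ε_j^{k_j + 1}` is `2^{#ι}` if every `k_j` is odd
and `0` otherwise. [folklore] -/
theorem sum_prod_neg_one_pow {ι : Type*} [Fintype ι] [DecidableEq ι] (k : ι → ℕ) :
    ∑ ε : ι → Fin 2, ∏ j, ((-1 : R) ^ (ε j : ℕ)) ^ (k j + 1) =
      if ∀ j, Odd (k j) then 2 ^ Fintype.card ι else 0 := by
  have h := Finset.prod_univ_sum (fun _ : ι => (Finset.univ : Finset (Fin 2)))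
    (fun j (e : Fin 2) => ((-1 : R) ^ (e : ℕ)) ^ (k j + 1))
  rw [Fintype.piFinset_univ] at h
  rw [← h]
  simp_rw [sum_neg_one_pow_pow, one_add_neg_one_pow_succ]
  split_ifs with hodd
  · rw [Finset.prod_congr rfl fun j _ => if_pos (hodd j), Finset.prod_const, Finset.card_univ]
  · simp only [not_forall] at hodd
    obtain ⟨j, hj⟩ := hodd
    exact Finset.prod_eq_zero (Finset.mem_univ j) (if_neg hj)

end Signs

/-! ## Fischer's identity (GKKS TR13-026, Lemma 4.3) -/

section Fischer

variable {R : Type*} [CommRing R] {ι : Type*} [Fintype ι] [DecidableEq ι]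

/-- A composition of `#ι` into `#ι` odd parts indexed by `ι` has all parts equal to `1`.
[folklore] -/
theorem eq_one_of_mem_piAntidiag_of_odd {k : ι → ℕ}
    (hk : k ∈ (Finset.univ : Finset ι).piAntidiag (Fintype.card ι)) (hodd : ∀ j, Odd (k j)) :
    k = fun _ => 1 := by
  rw [Finset.mem_piAntidiag] at hk
  have hle : ∀ j ∈ (Finset.univ : Finset ι), 1 ≤ k j := fun j _ => (hodd j).pos
  have hsum : ∑ j ∈ (Finset.univ : Finset ι), (1 : ℕ) = ∑ j ∈ Finset.univ, k j := by
    rw [hk.1, Finset.sum_const, smul_eq_mul, mul_one, Finset.card_univ]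
  have := (Finset.sum_eq_sum_iff_of_le hle).1 hsum
  funext j
  exact (this j (Finset.mem_univ j)).symm

omit [DecidableEq ι] in
/-- `multinomial (1, …, 1) = (#ι)!`. [folklore] -/
theorem multinomial_univ_const_one :
    Nat.multinomial (Finset.univ : Finset ι) (fun _ => 1) = (Fintype.card ι).factorial := by
  have h := Nat.multinomial_spec (Finset.univ : Finset ι) (fun _ => (1 : ℕ))
  simp only [Nat.factorial_one, Finset.prod_const_one, one_mul, Finset.sum_const, smul_eq_mul,
    mul_one, Finset.card_univ] at h
  exact h

/-- **Fischer's identity** (GKKS TR13-026 Lemma 4.3, after [Fis94]), symmetric form over any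
commutative ring: `∑_{ε ∈ {±1}^ι} (∏_j ε_j) (∑_j ε_j y_j)^{#ι} = 2^{#ι} (#ι)! ∏_j y_j`. Expanding
the power by the multinomial theorem, the sign sum kills every exponent vector with an even
entry, and the only composition of `#ι` into `#ι` odd parts is `(1, …, 1)`.
[cite: GuptaKamathKayalSaptharishi2016, Lemma 4.3] -/
theorem fischer (y : ι → R) :
    ∑ ε : ι → Fin 2, (∏ j, (-1 : R) ^ (ε j : ℕ)) * (∑ j, (-1 : R) ^ (ε j : ℕ) * y j) ^
        Fintype.card ι =
      ((2 ^ Fintype.card ι * (Fintype.card ι).factorial : ℕ) : R) * ∏ j, y j := by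
  set W := Fintype.card ι with hW
  set A := (Finset.univ : Finset ι).piAntidiag W with hA
  -- expand each power by the multinomial theorem and collect the signs
  have hexp : ∀ ε : ι → Fin 2,
      (∏ j, (-1 : R) ^ (ε j : ℕ)) * (∑ j, (-1 : R) ^ (ε j : ℕ) * y j) ^ W =
        ∑ k ∈ A, (Nat.multinomial Finset.univ k : R) * (∏ j, y j ^ k j) *
          ∏ j, ((-1 : R) ^ (ε j : ℕ)) ^ (k j + 1) := by
    intro ε
    rw [Finset.sum_pow_eq_sum_piAntidiag, Finset.mul_sum]
    refine Finset.sum_congr rfl fun k _ => ?_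
    have h1 : ∏ j, ((-1 : R) ^ (ε j : ℕ) * y j) ^ k j =
        (∏ j, ((-1 : R) ^ (ε j : ℕ)) ^ k j) * ∏ j, y j ^ k j := by
      rw [← Finset.prod_mul_distrib]
      exact Finset.prod_congr rfl fun j _ => mul_pow _ _ _
    have h2 : ∏ j, ((-1 : R) ^ (ε j : ℕ)) ^ (k j + 1) =
        (∏ j, (-1 : R) ^ (ε j : ℕ)) * ∏ j, ((-1 : R) ^ (ε j : ℕ)) ^ k j := by
      rw [← Finset.prod_mul_distrib]
      exact Finset.prod_congr rfl fun j _ => by ring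
    rw [h1, h2]
    ring
  simp_rw [hexp]
  rw [Finset.sum_comm]
  simp_rw [← Finset.mul_sum, sum_prod_neg_one_pow]
  have hone : (fun _ : ι => (1 : ℕ)) ∈ A := by
    rw [hA, Finset.mem_piAntidiag]
    refine ⟨?_, fun _ _ => Finset.mem_univ _⟩
    simp [hW]
  rw [Finset.sum_eq_single_of_mem _ hone]
  · rw [if_pos (fun _ => odd_one), multinomial_univ_const_one]
    simp only [pow_one]
    push_cast
    ring
  · intro k hk hne
    rw [if_neg, mul_zero]
    intro hodd
    exact hne (eq_one_of_mem_piAntidiag_of_odd hk hodd)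

/-- Fischer's identity in divided form over an algebra over a field of characteristic zero:
`∏_j y_j = (2^{#ι} (#ι)!)⁻¹ ∑_{ε} (∏_j ε_j)(∑_j ε_j y_j)^{#ι}` — a product of `#ι` factors is a
linear combination of `2^{#ι}` `#ι`-th powers of `±`-combinations of the factors.
[cite: GuptaKamathKayalSaptharishi2016, Lemma 4.3] -/
theorem fischer_inv {K : Type*} [Field K] [CharZero K] [Algebra K R] (y : ι → R) :
    ∏ j, y j = algebraMap K R ((2 ^ Fintype.card ι * (Fintype.card ι).factorial : ℕ) : K)⁻¹ *
      ∑ ε : ι → Fin 2, (∏ j, (-1 : R) ^ (ε j : ℕ)) *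
        (∑ j, (-1 : R) ^ (ε j : ℕ) * y j) ^ Fintype.card ι := by
  rw [fischer y, ← mul_assoc, ← map_natCast (algebraMap K R), ← map_mul, inv_mul_cancel₀,
    map_one, one_mul]
  exact_mod_cast (Nat.mul_pos (Nat.pow_pos two_pos) (Nat.factorial_pos _)).ne'

end Fischer

/-! ## Saxena's duality trick (GKKS TR13-026, Lemma 4.6) -/

section Duality

variable {K : Type*} [Field K] [CharZero K]

/-- Interpolation weights: for the nodes `0, 1, …, N` there are `β₀, …, β_N` with
`∑_u β_u u^e = W! · [e = W]` for all `e ≤ N` (a row of the inverse Vandermonde matrix; this is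
"via interpolation … there exist `δ₁, …, δ_{md+1}`" in the proof of TR13-026 Lemma 4.6).
[cite: GuptaKamathKayalSaptharishi2016, Lemma 4.6] -/
theorem exists_dual_weights (N W : ℕ) :
    ∃ β : Fin (N + 1) → K, ∀ e : Fin (N + 1),
      ∑ u : Fin (N + 1), β u * ((u : ℕ) : K) ^ (e : ℕ) =
        if (e : ℕ) = W then ((W.factorial : ℕ) : K) else 0 := by
  set v : Fin (N + 1) → K := fun u => ((u : ℕ) : K) with hv
  have hinj : Function.Injective v := by
    intro a b hab
    simp only [hv, Nat.cast_inj] at hab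
    exact Fin.ext hab
  have hdet : (Matrix.vandermonde v).det ≠ 0 := Matrix.det_vandermonde_ne_zero_iff.2 hinj
  have hunit : IsUnit (Matrix.vandermonde v) :=
    (Matrix.isUnit_iff_isUnit_det _).2 (isUnit_iff_ne_zero.2 hdet)
  obtain ⟨β, hβ⟩ := (Matrix.vecMul_surjective_iff_isUnit.2 hunit)
    (fun e : Fin (N + 1) => if (e : ℕ) = W then ((W.factorial : ℕ) : K) else 0)
  refine ⟨β, fun e => ?_⟩
  have h2 : Matrix.vecMul β (Matrix.vandermonde v) e =
      if (e : ℕ) = W then ((W.factorial : ℕ) : K) else 0 := congrFun hβ e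
  rw [Matrix.vecMul_apply_eq_sum] at h2
  simpa [Matrix.vandermonde_apply, hv] using h2

/-- The exponent vectors with entries `≤ W` and total `W` are exactly the compositions of `W`.
[folklore] -/
theorem filter_piFinset_range_eq_piAntidiag {ι : Type*} [Fintype ι] [DecidableEq ι] (W : ℕ) :
    (Fintype.piFinset fun _ : ι => Finset.range (W + 1)).filter
        (fun x => ∑ v, x v = W) = (Finset.univ : Finset ι).piAntidiag W := by
  ext x
  simp only [Finset.mem_filter, Fintype.mem_piFinset, Finset.mem_range, Finset.mem_piAntidiag,
    Finset.mem_univ, imp_true_iff, and_true]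
  constructor
  · exact fun h => h.2
  · intro h
    refine ⟨fun v => Nat.lt_succ_of_le ?_, h⟩
    rw [← h]
    exact Finset.single_le_sum (fun i _ => Nat.zero_le (x i)) (Finset.mem_univ v)

/-- `W! / ∏_v (k_v)! = multinomial(k)` in a field of characteristic zero, for a composition `k`
of `W`. [folklore] -/
theorem factorial_mul_prod_inv_factorial {ι : Type*} [Fintype ι] {k : ι → ℕ} {W : ℕ}
    (hk : ∑ v, k v = W) :
    ((W.factorial : ℕ) : K) * ∏ v, (((k v).factorial : ℕ) : K)⁻¹ =
      (Nat.multinomial Finset.univ k : K) := by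
  have hspec := Nat.multinomial_spec (Finset.univ : Finset ι) k
  rw [hk] at hspec
  have hne : (∏ v, (((k v).factorial : ℕ) : K)) ≠ 0 :=
    Finset.prod_ne_zero_iff.2 fun v _ => by exact_mod_cast (Nat.factorial_pos _).ne'
  rw [Finset.prod_inv_distrib, ← hspec]
  push_cast
  field_simp

/-- **Saxena's duality trick** (GKKS TR13-026 Lemma 4.6, [Sax08]): with the truncated exponential
`E_W(w) = ∑_{e ≤ W} w^e/e!`, the nodes `α_u = u` (`u ≤ N`, `N ≥ mW`) and the weights `β_u` of
`exists_dual_weights`, one has `(∑_v y_v)^W = ∑_u β_u ∏_v E_W(α_u y_v)` for all `y : ι → R` in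
any commutative `K`-algebra `R` — a power of a sum of `m` terms is a sum of `N + 1` products of
univariate polynomials in the individual terms. Proof as printed: `W! · coeff_{z^W} ∏_v E_W(y_v z)
= (∑_v y_v)^W` (multinomial theorem) and the coefficient is extracted by the weights.
[cite: GuptaKamathKayalSaptharishi2016, Lemma 4.6] -/
theorem duality {R : Type*} [CommRing R] [Algebra K R] {ι : Type*} [Fintype ι] [DecidableEq ι]
    {N W : ℕ} (hN : Fintype.card ι * W ≤ N) {β : Fin (N + 1) → K}
    (hβ : ∀ e : Fin (N + 1), ∑ u : Fin (N + 1), β u * ((u : ℕ) : K) ^ (e : ℕ) =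
      if (e : ℕ) = W then ((W.factorial : ℕ) : K) else 0)
    (y : ι → R) :
    ∑ u : Fin (N + 1), algebraMap K R (β u) *
        ∏ v, ∑ e ∈ Finset.range (W + 1),
          algebraMap K R ((((e.factorial : ℕ) : K)⁻¹) * ((u : ℕ) : K) ^ e) * y v ^ e =
      (∑ v, y v) ^ W := by
  set φ := algebraMap K R with hφ
  set P := Fintype.piFinset fun _ : ι => Finset.range (W + 1) with hP
  -- expand the products
  have hexp : ∀ u : Fin (N + 1),
      ∏ v, ∑ e ∈ Finset.range (W + 1),
          φ ((((e.factorial : ℕ) : K)⁻¹) * ((u : ℕ) : K) ^ e) * y v ^ e =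
        ∑ x ∈ P, φ (((u : ℕ) : K) ^ (∑ v, x v)) *
          (φ (∏ v, (((x v).factorial : ℕ) : K)⁻¹) * ∏ v, y v ^ x v) := by
    intro u
    rw [Finset.prod_univ_sum]
    refine Finset.sum_congr rfl fun x _ => ?_
    rw [Finset.prod_mul_distrib, ← map_prod, Finset.prod_mul_distrib, Finset.prod_pow_eq_pow_sum,
      map_mul]
    ring
  simp_rw [hexp, Finset.mul_sum]
  rw [Finset.sum_comm]
  -- the weights extract the exponent vectors of total degree `W`
  have hsum_le : ∀ x ∈ P, ∑ v, x v ≤ N := by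
    intro x hx
    rw [hP, Fintype.mem_piFinset] at hx
    calc ∑ v, x v ≤ ∑ _v : ι, W :=
          Finset.sum_le_sum fun v _ => Nat.le_of_lt_succ (Finset.mem_range.1 (hx v))
      _ = Fintype.card ι * W := by rw [Finset.sum_const, smul_eq_mul, Finset.card_univ]
      _ ≤ N := hN
  have hinner : ∀ x ∈ P,
      ∑ u : Fin (N + 1), φ (β u) * (φ (((u : ℕ) : K) ^ (∑ v, x v)) *
          (φ (∏ v, (((x v).factorial : ℕ) : K)⁻¹) * ∏ v, y v ^ x v)) =
        if ∑ v, x v = W then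
          φ (((W.factorial : ℕ) : K) * ∏ v, (((x v).factorial : ℕ) : K)⁻¹) * ∏ v, y v ^ x v
        else 0 := by
    intro x hx
    have hcollect : ∑ u : Fin (N + 1), φ (β u) * (φ (((u : ℕ) : K) ^ (∑ v, x v)) *
        (φ (∏ v, (((x v).factorial : ℕ) : K)⁻¹) * ∏ v, y v ^ x v)) =
        φ (∑ u : Fin (N + 1), β u * ((u : ℕ) : K) ^ (∑ v, x v)) *
          (φ (∏ v, (((x v).factorial : ℕ) : K)⁻¹) * ∏ v, y v ^ x v) := by
      rw [map_sum, Finset.sum_mul]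
      refine Finset.sum_congr rfl fun u _ => ?_
      rw [map_mul]
      ring
    rw [hcollect]
    have := hβ ⟨∑ v, x v, Nat.lt_succ_of_le (hsum_le x hx)⟩
    simp only at this
    rw [this]
    split_ifs with h
    · simp only [map_mul]
      ring
    · rw [map_zero, zero_mul]
  rw [Finset.sum_congr rfl hinner, ← Finset.sum_filter, filter_piFinset_range_eq_piAntidiag,
    Finset.sum_pow_eq_sum_piAntidiag]
  refine Finset.sum_congr rfl fun k hk => ?_
  rw [Finset.mem_piAntidiag] at hk
  rw [factorial_mul_prod_inv_factorial hk.1, map_natCast]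

end Duality

/-! ## Truncated exponentials of powers of a form, and splitting over an algebraically closed field
(GKKS TR13-026, proof of Lemma 4.7) -/

section Split

open Polynomial

variable {K : Type*} [Field K] {R : Type*} [CommRing R] [Algebra K R]

/-- `E_W(α · a ℓ^{e₀}) = g(ℓ)` for the univariate `g = ∑_{e ≤ W} (α^e a^e / e!) X^{e₀ e}`
("`f'_{ij}(t) = f_{ij}(t^{e_j})`" in the proof of TR13-026 Lemma 4.7).
[cite: GuptaKamathKayalSaptharishi2016, Lemma 4.7] -/
theorem truncExp_eq_aeval (W e₀ : ℕ) (α a : K) (ℓ : R) :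
    ∑ e ∈ Finset.range (W + 1),
        algebraMap K R ((((e.factorial : ℕ) : K)⁻¹) * α ^ e) * (algebraMap K R a * ℓ ^ e₀) ^ e =
      Polynomial.aeval ℓ (∑ e ∈ Finset.range (W + 1),
        Polynomial.C ((((e.factorial : ℕ) : K)⁻¹) * α ^ e * a ^ e) * Polynomial.X ^ (e₀ * e)) := by
  rw [map_sum]
  refine Finset.sum_congr rfl fun e _ => ?_
  simp only [map_mul, map_pow, Polynomial.aeval_C, Polynomial.aeval_X, pow_mul]
  ring

/-- The univariate `g` of `truncExp_eq_aeval` has degree `≤ e₀ W`.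
[cite: GuptaKamathKayalSaptharishi2016, Lemma 4.7] -/
theorem natDegree_truncExp_le (W e₀ : ℕ) (α a : K) :
    (∑ e ∈ Finset.range (W + 1),
        Polynomial.C ((((e.factorial : ℕ) : K)⁻¹) * α ^ e * a ^ e) *
          Polynomial.X ^ (e₀ * e)).natDegree ≤ e₀ * W := by
  refine Polynomial.natDegree_sum_le_of_forall_le _ _ fun e he => ?_
  refine (Polynomial.natDegree_C_mul_X_pow_le _ _).trans ?_
  exact Nat.mul_le_mul_left _ (Nat.le_of_lt_succ (Finset.mem_range.1 he))

/-- Over an algebraically closed field every univariate `g` factors into linear factors, so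
`g(ℓ) = lc(g) · ∏_{ρ ∈ roots g} (ℓ - ρ)` in any `K`-algebra, with `#roots g = deg g` ("since each
`f'_{ij}(t)` … splits as a product of linear factors over the algebraically closed base field",
proof of TR13-026 Lemma 4.7). [cite: GuptaKamathKayalSaptharishi2016, Lemma 4.7] -/
theorem aeval_eq_leadingCoeff_mul_prod_roots [IsAlgClosed K] (g : K[X]) (ℓ : R) :
    Polynomial.aeval ℓ g =
        algebraMap K R g.leadingCoeff * (g.roots.map fun ρ => ℓ - algebraMap K R ρ).prod ∧
      g.roots.card = g.natDegree := by
  have hs : g.Splits := IsAlgClosed.splits g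
  refine ⟨?_, hs.natDegree_eq_card_roots.symm⟩
  conv_lhs => rw [hs.eq_prod_roots]
  rw [map_mul, Polynomial.aeval_C, map_multiset_prod, Multiset.map_map]
  congr 1
  congr 1
  refine Multiset.map_congr rfl fun ρ _ => ?_
  simp [Function.comp]

end Split

end Literature.Computability.AlgebraicComplexity.DepthThreeChasm
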